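import Summits.ABC.IUTFork.Thm311RealInd1StripTwistDiekert
import HarnessLib

/-!
# [IUTchIII] Thm 3.11 (i) (Ind1) at a DYADIC place `v ∣ 2` with `√−1 ∈ K_v`: Nishio's shear realised in print's (Ind1) strip part is a shear
# ALONG THE TRACE-ZERO HYPERPLANE (`Tr_{K_v/ℚ_2}(y_{d−1}) = 0`, trace rigidity — unconditional, `p`-generic), and at `K_v ≅ ℚ_2(√−1)` it
# is the shear along the trace-zero LINE (the dyadic twin of the quadratic `K_v` of `Thm311RealInd1StripTwistJWFirstPlanes` §4)

PROOF-ONLY file (abc-iut cell, Cor. 3.12 sub-crew, seat abc-iut-c312-1 = holder of record of the typed [IUTchIII] Thm. 3.11, gen 23; row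
R33 «C:P2-DIEKERT-TWIST» sequel, offer (φ); CONDITIONAL on the named fact `DiekertNishioTwists` of
`Literature/AnabelianGeometry/AbsoluteAnabelian/MLFGaloisDiekertTwists.lean` (p592322), over `Thm311RealInd1StripTwistDiekert` (p592731)).
TAKES NO SIDE on [IUTchIII] Cor. 3.12.  No definition, no `Prop` fact.
* §1 **`Real.exists_realised_shear_trace_zero_of_diekertNishio`** — the data of `exists_realised_shear_of_diekertNishio` (basis `y` of
  `K_v^{(1/n_v)}` indexed by `Fin (d−2) ⊕ Fin 2`, `ψ₀ ∈ Real.ind1StripOf v (Real.galoisLog v)` with `ψ₀(x) = x + y^*_{inr 1}(x)·y_{inr 0}`)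
  with, IN ADDITION, `Tr_{K_v/ℚ_2}(y_{inr 0}) = 0`: by the UNCONDITIONAL, `p`-generic trace rigidity of print's (Ind1) strip part (gen 11
  `trace_apply_eq_of_mem_ind1StripOf`: every realised strip automorphism preserves `Tr_{K_v/ℚ_p}`), `Tr(y_d + y_{d−1}) = Tr(ψ₀ y_d) = Tr(y_d)`
  — Nishio Lemma 3.2 (= Hoshi–Nishio Lemma 2.3 (ii)) «`α_+` … restricts to an automorphism of `Ker(Tr_{k/k^{(d=1)}})`» in kernel form at
  the shear direction.
* §2 **`Real.exists_shear_of_diekertNishio_of_localDeg_eq_two`** — at every place with `[K_v : ℚ_2] = 2` and `√−1 ∈ K_v` (i.e. `K_v ≅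
  ℚ_2(√−1)`, the `(e,f) = (2,1)` dyadic places of abc-iut-E's `UnitLogDyadicSqrtNegOne`, where `log_2(𝒪^×) = 𝔪³` IS a ball): a `ℚ_2`-basis
  `(y_0, y_1)` of `K_v^{(1/n_v)}` and `ψ₀ ∈ Real.ind1StripOf v (Real.galoisLog v)` with `ψ₀(x) = x + y_1^*(x)·y_0`, `Tr(y_0) = 0`,
  `Tr(y_1) ≠ 0`, `Ker(Tr_{K_v/ℚ_2}) = ℚ_2·y_0` — a SHEAR ALONG THE TRACE-ZERO LINE, exactly the shape gen 12 found at the quadratic `K_v`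
  for `p` odd (`exists_shear_of_jannsenWingbergFirst_of_localDeg_eq_two`); Nishio Lemma 3.3's computation «`α^n_+(i) = c·i`» lives on
  this line (`Ker Tr = ℚ_2·i`).
HONEST SCOPE: conditional theorems (binder `hDN`) about OUR typed objects at ONE dyadic place; STRUCTURE only — NOTHING about hulls,
rooms, bits or the `p = 2` summand identity of R32; the position of `y_0` against `𝒪_v`-lattices (hence whether `ψ₀` moves an
ideal-shaped region such as `𝔪³`) is NOT pinned by print; nothing here asserts or refutes [IUTchIII] Cor. 3.12; no side taken; NO abc
claim. [claim: Mochizuki2012, status: disputed]; [cite: Mochizuki2012, IUTchIII Thm. 3.11 (i) (Ind1) p. 154]; [cite: Nishio2025OuterAutDyadic,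
Def. 2.5, Thm. 2.6, Lem. 3.2, Lem. 3.3]; [cite: HoshiNishio2022OuterAutMLF, Lemma 2.3 (ii) p.7]; [cite: Diekert1984, Thm. 3.1 (J. reine
angew. Math. 350, pp. 152–172)]. typed ≠ proved; a conditional theorem discharges nothing it binds.
-/

set_option autoImplicit false

noncomputable section

open Metric Set
open scoped Pointwise

namespace Summit.ABC.IUTFork.Thm311.Real

open NumberField IsDedekindDomain Literature.NumberTheory.NumberFields Literature.IUT.LogVolume
open Literature.NumberTheory.GaloisRepresentations
open Literature.AnabelianGeometry.AbsoluteAnabelian Literature.IUT.HodgeArakelov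
open Literature.IUT.HodgeArakelov.AbsTopMonoids

variable {F : Type} [Field F] [NumberField F] (v : HeightOneSpectrum (𝓞 F))

/-- **The dyadic shear direction is TRACE-ZERO.**  Assume `DiekertNishioTwists`.  At every finite place `v ∣ 2` with `√−1 ∈ K_v` and
`d = [K_v : ℚ_2] ≥ 2`: the data of `exists_realised_shear_of_diekertNishio` (`d = g + 2`, basis `y : Fin g ⊕ Fin 2`, `ψ₀ ∈ Real.ind1StripOf v
(Real.galoisLog v)` acting as `x ↦ x + y^*_{inr 1}(x)·y_{inr 0}`) with, IN ADDITION, `Tr_{K_v/ℚ_2}(y_{inr 0}) = 0` — trace rigidity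
(`trace_apply_eq_of_mem_ind1StripOf`, unconditional) at `x = y_{inr 1}`: `Tr(y_{inr 1} + y_{inr 0}) = Tr(y_{inr 1})`.  So the shear moves every
point inside the trace-zero hyperplane through it (Nishio Lem. 3.2 / Hoshi–Nishio Lem. 2.3 (ii)). [claim: Mochizuki2012, status: disputed]
[cite: Nishio2025OuterAutDyadic, Thm. 2.6, Lem. 3.2] [cite: HoshiNishio2022OuterAutMLF, Lemma 2.3 (ii) p.7] -/
theorem exists_realised_shear_trace_zero_of_diekertNishio (hDN : DiekertNishioTwists)
    (p : ℕ) [Fact p.Prime] (hv : ((p : ℕ) : 𝓞 F) ∈ v.asIdeal) (hp2 : p = 2) (hi : ∃ i : v.adicCompletion F, i ^ 2 = -1)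
    (h2 : 2 ≤ localDeg F v) :
    ∃ (g : ℕ) (_ : localDeg F v = g + 2) (y : Module.Basis (Fin g ⊕ Fin 2) ℚ_[p] (RescaledCompletion F p v hv))
      (ψ₀ : v.adicCompletion F ≃+ v.adicCompletion F),
      ψ₀ ∈ ind1StripOf v (galoisLog v) ∧
      (∀ x : RescaledCompletion F p v hv,
        RescaledCompletion.of F p v hv (ψ₀ ((RescaledCompletion.of F p v hv).symm x)) = x + y.coord (Sum.inr 1) x • y (Sum.inr 0)) ∧
      Algebra.trace ℚ_[p] (RescaledCompletion F p v hv) (y (Sum.inr 0)) = 0 := by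
  obtain rfl : p = (closureAt v).residueChar := eq_residueChar_closureAt_of_natCast_mem v hv
  obtain ⟨g, hcard, y, ψ₀, hψ₀, hT₀⟩ := exists_realised_shear_of_diekertNishio v hDN (closureAt v).residueChar hv hp2 hi h2
  have hcoord : ∀ s t : Fin g ⊕ Fin 2, y.coord s (y t) = if t = s then 1 else 0 := by
    intro s t
    rw [Module.Basis.coord_apply, Module.Basis.repr_self, Finsupp.single_apply]
  refine ⟨g, hcard, y, ψ₀, hψ₀, hT₀, ?_⟩
  -- `Tr(y_d + y_{d−1}) = Tr(y_d)`
  have h := trace_apply_eq_of_mem_ind1StripOf v hψ₀ ((RescaledCompletion.of F (closureAt v).residueChar v hv).symm (y (Sum.inr 1)))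
  rw [hT₀, RingEquiv.apply_symm_apply, hcoord, if_pos rfl, one_smul, map_add, add_eq_left] at h
  exact h

/-- **THE PLACES `K_v ≅ ℚ_2(√−1)` — a SHEAR ALONG THE TRACE-ZERO LINE in print's (Ind1) strip part.**  Assume `DiekertNishioTwists`.  At every
finite place `v ∣ 2` with `√−1 ∈ K_v` and `[K_v : ℚ_2] = 2` there are a `ℚ_2`-basis `(y_0, y_1)` of `K_v^{(1/n_v)}` and `ψ₀ ∈ Real.ind1StripOf v
(Real.galoisLog v)` with `ψ₀(x) = x + y_1^*(x)·y_0`, `Tr(y_0) = 0`, `Tr(y_1) ≠ 0` and `Ker(Tr_{K_v/ℚ_2}) = ℚ_2·y_0` (`Tr 1 = 2 ≠ 0`, so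
`dim Ker Tr = 1`).  The dyadic twin of `exists_shear_of_jannsenWingbergFirst_of_localDeg_eq_two`; the position of `y_0` against a given
`𝒪_v`-lattice is NOT pinned by print. [claim: Mochizuki2012, status: disputed] [cite: Nishio2025OuterAutDyadic, Def. 2.5, Thm. 2.6, Lem. 3.3]
[cite: HoshiNishio2022OuterAutMLF, Lemma 2.3 (ii) p.7] -/
theorem exists_shear_of_diekertNishio_of_localDeg_eq_two (hDN : DiekertNishioTwists)
    (p : ℕ) [Fact p.Prime] (hv : ((p : ℕ) : 𝓞 F) ∈ v.asIdeal) (hp2 : p = 2) (hi : ∃ i : v.adicCompletion F, i ^ 2 = -1)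
    (hd : localDeg F v = 2) :
    ∃ (y : Module.Basis (Fin 2) ℚ_[p] (RescaledCompletion F p v hv)) (ψ₀ : v.adicCompletion F ≃+ v.adicCompletion F),
      ψ₀ ∈ ind1StripOf v (galoisLog v) ∧
      (∀ x : RescaledCompletion F p v hv,
        RescaledCompletion.of F p v hv (ψ₀ ((RescaledCompletion.of F p v hv).symm x)) = x + y.coord 1 x • y 0) ∧
      Algebra.trace ℚ_[p] (RescaledCompletion F p v hv) (y 0) = 0 ∧
      Algebra.trace ℚ_[p] (RescaledCompletion F p v hv) (y 1) ≠ 0 ∧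
      LinearMap.ker (Algebra.trace ℚ_[p] (RescaledCompletion F p v hv)) = Submodule.span ℚ_[p] {y 0} := by
  obtain ⟨g, hcard, y, ψ₀, hψ₀, hT₀, ht0⟩ := exists_realised_shear_trace_zero_of_diekertNishio v hDN p hv hp2 hi (by omega)
  have hg : g = 0 := by omega
  subst hg
  haveI : FiniteDimensional ℚ_[p] (RescaledCompletion F p v hv) := FiniteDimensional.of_locallyCompactSpace ℚ_[p]
  set Tr := Algebra.trace ℚ_[p] (RescaledCompletion F p v hv) with hTr
  have hfin : Module.finrank ℚ_[p] (RescaledCompletion F p v hv) = localDeg F v :=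
    (RescaledCompletion.localDeg_eq_finrank F p v hv).symm
  -- reindex `Fin 0 ⊕ Fin 2 ≃ Fin 2`
  let ε : Fin 0 ⊕ Fin 2 ≃ Fin 2 := Equiv.emptySum (Fin 0) (Fin 2)
  let y2 : Module.Basis (Fin 2) ℚ_[p] (RescaledCompletion F p v hv) := y.reindex ε
  have hy2 : ∀ t : Fin 2, y2 t = y (Sum.inr t) := fun t => by
    rw [Module.Basis.reindex_apply]; rfl
  have hy2c : ∀ (t : Fin 2) x, y2.coord t x = y.coord (Sum.inr t) x := fun t x => by
    rw [Module.Basis.coord_apply, Module.Basis.coord_apply, Module.Basis.repr_reindex_apply]; rfl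
  -- `Tr 1 = 2 ≠ 0`
  have hTr1 : Tr 1 ≠ 0 := by
    rw [hTr, ← map_one (algebraMap ℚ_[p] (RescaledCompletion F p v hv)), Algebra.trace_algebraMap, hfin, nsmul_eq_mul, mul_one]
    exact_mod_cast (show localDeg F v ≠ 0 by omega)
  -- `Tr(y_1) ≠ 0`: otherwise every basis vector is trace-zero and `Tr = 0`
  have ht1 : Tr (y2 1) ≠ 0 := by
    intro h1
    apply hTr1
    have hall : ∀ s, Tr (y2 s) = 0 := by
      intro s
      fin_cases s
      · rw [hy2]; exact ht0
      · exact h1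
    have hzero : Tr = 0 := y2.ext fun s => by rw [hall s, LinearMap.zero_apply]
    rw [hzero, LinearMap.zero_apply]
  -- `Ker Tr = ℚ_2·y_0`: `⊇` by `Tr(y_0) = 0`, and both sides have dimension `1`
  have hle : Submodule.span ℚ_[p] {y2 0} ≤ LinearMap.ker Tr := by
    rw [Submodule.span_le, Set.singleton_subset_iff]
    exact (LinearMap.mem_ker).mpr (by rw [hy2]; exact ht0)
  have hrangeTr : LinearMap.range Tr = ⊤ := by
    rw [eq_top_iff]
    intro t _
    refine ⟨(t / Tr 1) • (1 : RescaledCompletion F p v hv), ?_⟩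
    rw [map_smul, smul_eq_mul, div_mul_cancel₀ t hTr1]
  have hker : Module.finrank ℚ_[p] (LinearMap.ker Tr) = 1 := by
    have h := LinearMap.finrank_range_add_finrank_ker Tr
    rw [hrangeTr, finrank_top, Module.finrank_self, hfin, hd] at h
    omega
  have hspan : Module.finrank ℚ_[p] (Submodule.span ℚ_[p] ({y2 0} : Set (RescaledCompletion F p v hv))) = 1 :=
    finrank_span_singleton (y2.ne_zero 0)
  have heq : Submodule.span ℚ_[p] {y2 0} = LinearMap.ker Tr :=
    Submodule.eq_of_le_of_finrank_eq hle (by rw [hspan, hker])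
  refine ⟨y2, ψ₀, hψ₀, fun x => ?_, by rw [hy2]; exact ht0, ht1, heq.symm⟩
  rw [hT₀, hy2c, hy2]

end Summit.ABC.IUTFork.Thm311.Real

end
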